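/-
Copyright (c) 2026 the pub-hodgecm-mathlib formalisation cell (harness21).  Prover seat hodgecm-mathlib-LH4-p07 (g9), req620 Track A «(D-RAM) FOUR-FRAME» squad
(STAGE-1b, row-(2) lineage; dealer LH4-plan (g13) WORD #58 RULING A ∕ #59 ∕ #64: owner of the two-literal census law of `lev_{a,m}`, hand (T5-P-coneΔ)-RamK), 2026-09-04.
-/
import Summits.HodgeConjecture.HodgeConjecture.Theorems.F0P3cDyRamToricCensusSumRamKCut   -- ★ p859753 (this seat): `toricCensusSum_ramK_cut` (T5s-RamK with a diagonal cutoff)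
import HarnessLib

/-!
# Crux `H413`, line LH4 «(D-RAM) FOUR-FRAME» — STAGE-1b, row (2): (T5-P-coneΔ-R2)-RamK, ALIVE OFFSET «THE CUT WELD DOES NOT SEE THE SCALED MULTIPLIER'S ALIVE SHIFT»
# `hvTop` with `2j + d ≤ 2jl + 1 + e` in place of `2j + d ≤ 2jl + 1`, cutoff `C + d ≤ m + jl + 1` ⇒ the cut weld has ★ p859753's value VERBATIM

Cell `hodgecm-mathlib` (D-0151), FLOOR 0, crux item H413 = `stmt-HodgeConjecture-24833`, route of record `HCCMUnconditional`; squad F0∕P3c∕LH4; lane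
`--supports stmt-HodgeConjecture-24833 --as helper` (count-neutral; pays NO tier-0 row).  THEOREMS ONLY (no `def`, no instance, no notation, no `sorry`, default heartbeats).
OWNER'S ORGAN №4 for the END `levels_typeTwo_censusLaw`.

THE POINT.  The cone cells of a template piece `lev_{a′,b′}` are the cells of the SCALED multiplier `μ₁ = (jE c)⁻¹(lam − jE u₀₀)`, `|jE c| = |jE ϖ|^{a′}` (★ p859713).  Their generic ∕
off-diagonal tables are ★ (D0)–(D2) at `μ₁`'s tokens `(m₁, jl₁) = (m − a′, jl − a′)` (type-free ★ `ncard_levelSetDep_zero ∕ _offDiag ∕ _diag_low`, any multiplier), and the top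
diagonal's INDEX form is ★ `ncard_levelSetDep_top_mul_eq_of_ramK_of_frame` (any multiplier); but the top cells' ALIVE law is a law of the element's twist `κ = ρμ∕μ = ρμ₁∕μ₁` and of the
unit `z` of the two line models (★ F0P3-p01 (g33) `…RamKTopValue` §3: `ALIVE(z, c′) ⟺ c′ + d ≤ jl + 1 ∧ …` with the UNSCALED conductor `jl = jl₁ + a′`), so in `μ₁`'s tokens the
`hvTop` sentence of ★ T5s reads with the alive condition `2j + d ≤ 2jl₁ + 1 + a′` — an OFFSET `e = a′`.  THIS FILE shows the offset is invisible to the CUT weld: under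
`C + d ≤ m + jl + 1` (near `1`: `D = b′ − 2a′ ≥ d − 1`, true for `sq_{m*}`, `lev_{ℓ₀,m*}`, `lev_{ℓ₀+1,m*}`) every top cell inside the cutoff has `2j + d ≤ 2jl + 1`, so the tables may be
re-cut at the standard boundary without changing the cut sum, and ★ p859753 applies:
* §1 `cutSum_eq_of_agree_below_alive` — two table pairs agreeing off the band «top diagonal ∧ `2jl + 1 < 2j + d`» have equal cut sums when `C + d ≤ m + jl + 1`;
* §2 **`toricCensusSum_ramK_cut_offset`** — ★ T5s's binders with `hvTopE` (alive `2j + d ≤ 2jl + 1 + e`, any `e : ℕ`) + `(C) (hC : jl ≤ C) (hCe : C + d ≤ m + jl + 1)`: the cut weld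
  `ε·Σ_jΣ_a q^a·[j + a ≤ C]·(vP − vM)` has ★ p859753's value (★ weld − the cut band).  Proof: re-cut tables `wP∕wM` (standard `hvTop`), §1, ★ p859753.
The same two steps transfer any future closed form of the cut weld in the flipped parity class (T5s♭) to offset tables; numeric twin `F0/P3c/LH4/LH4-p07/g9/LAW-FIT-RamK.v*.md`.
HONEST LABEL.  Count-neutral finite-sum bookkeeping over ℚ on ABSTRACT tables; the value of `e` for the pieces (`e = a′`) is the (D3♯) organ's to prove, not asserted here; no census law is
stated; `HC_CM` is proved only modulo the 7 printed citations (2 remaining named inputs: hLiu418 = `stmt-HodgeConjecture-24832`, h413 = `stmt-HodgeConjecture-24833`) until rung 0 closes.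

## References
* [Kottwitz1986BaseChangeUnits] R. E. Kottwitz, *Base change for unit elements of Hecke algebras*, Compositio Math. 60 (1986): §1 pp. 240–241.
* [Rogawski1990] J. D. Rogawski, *Automorphic Representations of Unitary Groups in Three Variables*, Ann. of Math. Stud. 123 (1990): §4.9 Prop. 4.9.1 (b) p. 55, Lemma 4.9.3 p. 56.
* [Flicker1998UnitaryFL] Y. Z. Flicker, *Elementary proof of the fundamental lemma for a unitary group*, Canad. J. Math. 50 (1998): Prop. 7 p. 84 (the level tables).
-/

set_option autoImplicit false

namespace Summit.HodgeConjecture.HodgeConjecture.Cruxes.H413.F0P3cDyRamToricCensusSumRamKCutOffset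

open Finset
open Summit.HodgeConjecture.HodgeConjecture.Cruxes.H413.F0P3cDyRamToricCensusSumRamKCut (toricCensusSum_ramK_cut)

/-! ## §1 Tables agreeing below the alive boundary have equal cut sums -/

/-- **THE CUT SUM DOES NOT SEE THE CELLS BEYOND THE ALIVE BOUNDARY.**  Two table pairs `(vP, vM)`, `(wP, wM)` agreeing on every cell except possibly on top-diagonal cells
(`j + m = jl + a`) beyond the standard alive boundary (`2jl + 1 < 2j + d`) have the same cut sum as soon as `C + d ≤ m + jl + 1` (those cells are cut).
[cite: Kottwitz1986BaseChangeUnits, §1 pp. 240–241] -/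
theorem cutSum_eq_of_agree_below_alive (x : ℚ) {d jl m C : ℕ} (hCe : C + d ≤ m + jl + 1) (vP vM wP wM : ℕ → ℕ → ℚ)
    (hagree : ∀ j a, ¬ (j + m = jl + a ∧ 2 * jl + 1 < 2 * j + d) → vP j a = wP j a ∧ vM j a = wM j a) :
    ∑ j ∈ range (jl + 1), ∑ a ∈ range (jl + 2), x ^ a * (if j + a ≤ C then vP j a - vM j a else 0) =
      ∑ j ∈ range (jl + 1), ∑ a ∈ range (jl + 2), x ^ a * (if j + a ≤ C then wP j a - wM j a else 0) := by
  refine sum_congr rfl fun j _ => sum_congr rfl fun a _ => ?_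
  by_cases hcut : j + a ≤ C
  · have hna : ¬ (j + m = jl + a ∧ 2 * jl + 1 < 2 * j + d) := by omega
    obtain ⟨hP, hM⟩ := hagree j a hna
    rw [hP, hM]
  · rw [if_neg hcut, if_neg hcut]

/-! ## §2 The cut weld with an alive offset -/

/-- **(T5-P-coneΔ-R2)-RamK WITH AN ALIVE OFFSET.**  ★ T5s `toricCensusSum_ramK`'s binders with the top rows' alive condition SHIFTED to `2j + d ≤ 2jl + 1 + e` (`hvTopE`; the
cells of a SCALED multiplier `μ₁ = (jE c)⁻¹(lam − jE u₀₀)`, `|jE c| = |jE ϖ|^{a′}`, are alive up to the UNSCALED conductor: `e = a′`), a cutoff `C` with `jl ≤ C` and `C + d ≤ m + jl + 1`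
(the offset band is cut): the cut weld has ★ p859753's value VERBATIM. [cite: Kottwitz1986BaseChangeUnits, §1 pp. 240–241] [cite: Rogawski1990, §4.9 Prop. 4.9.1 (b) p. 55, Lemma 4.9.3 p. 56]
[cite: Flicker1998UnitaryFL, Prop. 7 p. 84] -/
theorem toricCensusSum_ramK_cut_offset (q : ℕ) {d jl m : ℕ} (ε : ℚ) (hq : 2 ≤ q) (hd : 2 ≤ d) (hjl : jl % 2 = d % 2) (hjlS : 3 * d ≤ jl + 2 + 2 * (d % 2))
    (hpar : m % 2 = d % 2) (hmS : d - d % 2 ≤ m + 1) (hm : m ≤ jl) (hε : ε = 1 ∨ (ε = -1 ∧ jl + 2 ≤ m + 2 * d))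
    (nP nM vP vM : ℕ → ℕ → ℚ)
    (hnP : ∀ j a, nP j a = ((if j = 0 then (if a = 0 then 1 else 0) else if j < a ∨ (j - a) % 2 = 1 then 0
      else if a = j then (if 2 ≤ d then q ^ j else (q - 1) * q ^ (j - 1)) else if a = 0 then (if 2 * d ≤ j + 1 then 2 else 1) * q ^ (j / 2)
      else if j - a + 2 < 2 * d then (q - 1) * q ^ (j - 1 - (j - a) / 2) else if j - a + 2 = 2 * d then (q - 2) * q ^ (j - d)
      else 2 * (q - 1) * q ^ (j - 1 - (j - a) / 2) : ℕ) : ℚ))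
    (hnM : ∀ j a, nM j a = ((if j = 0 then (if a = 0 then 1 else 0) else if j < a ∨ (j - a) % 2 = 1 then 0
      else if a = j then (if 2 ≤ d then q ^ j else (q + 1) * q ^ (j - 1)) else if a = 0 then (if j + 2 ≤ 2 * d then q ^ (j / 2) else 0)
      else if j - a + 2 < 2 * d then (q - 1) * q ^ (j - 1 - (j - a) / 2) else if j - a + 2 = 2 * d then q ^ (j - d + 1) else 0 : ℕ) : ℚ))
    (hvGen : ∀ j a, (a ≤ m ∧ (j + a ≤ m ∨ (2 * a ≤ m ∧ j + a ≤ jl))) → vP j a = nP j a ∧ vM j a = nM j a)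
    (hvOff : ∀ j a, ¬ (a ≤ m ∧ (j + a ≤ m ∨ (2 * a ≤ m ∧ j + a ≤ jl))) → j + m ≠ jl + a → vP j a = 0 ∧ vM j a = 0)
    (e : ℕ)
    (hvTopE : ∀ j a, ¬ (a ≤ m ∧ (j + a ≤ m ∨ (2 * a ≤ m ∧ j + a ≤ jl))) → j + m = jl + a →
      (vP j a = if 2 * j + d ≤ 2 * jl + 1 + e ∧ (j + a + 2 ≤ m + 2 * d ∨ ε = 1) then (if j + a + 2 ≤ m + 2 * d then 1 else 2) * (q : ℚ) ^ (j - (j + a - m + 1) / 2) else 0) ∧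
      (vM j a = if 2 * j + d ≤ 2 * jl + 1 + e ∧ (j + a + 2 ≤ m + 2 * d ∨ ε = -1) then (if j + a + 2 ≤ m + 2 * d then 1 else 2) * (q : ℚ) ^ (j - (j + a - m + 1) / 2) else 0))
    (C : ℕ) (hC : jl ≤ C) (hCe : C + d ≤ m + jl + 1) :
    ε * ∑ j ∈ range (jl + 1), ∑ a ∈ range (jl + 2), (q : ℚ) ^ a * (if j + a ≤ C then vP j a - vM j a else 0) =
      (q : ℚ) ^ m * (2 * ∑ i ∈ range ((jl - d) / 2 + 1), (q : ℚ) ^ i - 2 * ∑ i ∈ range (d - d % 2), (q : ℚ) ^ i) -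
        2 * ∑ a ∈ (range (jl + 2)).filter (fun a => a ≤ m ∧ C + m < jl + 2 * a ∧ 2 * m + 2 * d < jl + 2 * a + 2 ∧ 2 * a + d ≤ 2 * m + 1), (q : ℚ) ^ (a + jl / 2) := by
  classical
  -- the standard-alive tables: the given ones, re-cut at `2j + d ≤ 2jl + 1` on the top diagonal
  set wP : ℕ → ℕ → ℚ := fun j a => if ¬ (a ≤ m ∧ (j + a ≤ m ∨ (2 * a ≤ m ∧ j + a ≤ jl))) ∧ j + m = jl + a then
      (if 2 * j + d ≤ 2 * jl + 1 ∧ (j + a + 2 ≤ m + 2 * d ∨ ε = 1) then (if j + a + 2 ≤ m + 2 * d then 1 else 2) * (q : ℚ) ^ (j - (j + a - m + 1) / 2) else 0)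
    else vP j a with hwP
  set wM : ℕ → ℕ → ℚ := fun j a => if ¬ (a ≤ m ∧ (j + a ≤ m ∨ (2 * a ≤ m ∧ j + a ≤ jl))) ∧ j + m = jl + a then
      (if 2 * j + d ≤ 2 * jl + 1 ∧ (j + a + 2 ≤ m + 2 * d ∨ ε = -1) then (if j + a + 2 ≤ m + 2 * d then 1 else 2) * (q : ℚ) ^ (j - (j + a - m + 1) / 2) else 0)
    else vM j a with hwM
  have hwGen : ∀ j a, (a ≤ m ∧ (j + a ≤ m ∨ (2 * a ≤ m ∧ j + a ≤ jl))) → wP j a = nP j a ∧ wM j a = nM j a := fun j a hg => by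
    obtain ⟨h1, h2⟩ := hvGen j a hg
    rw [hwP, hwM]; dsimp only
    rw [if_neg (fun h => h.1 hg), if_neg (fun h => h.1 hg), h1, h2]
    exact ⟨rfl, rfl⟩
  have hwOff : ∀ j a, ¬ (a ≤ m ∧ (j + a ≤ m ∨ (2 * a ≤ m ∧ j + a ≤ jl))) → j + m ≠ jl + a → wP j a = 0 ∧ wM j a = 0 := fun j a hg hoff => by
    obtain ⟨h1, h2⟩ := hvOff j a hg hoff
    rw [hwP, hwM]; dsimp only
    rw [if_neg (fun h => hoff h.2), if_neg (fun h => hoff h.2), h1, h2]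
    exact ⟨rfl, rfl⟩
  have hwTop : ∀ j a, ¬ (a ≤ m ∧ (j + a ≤ m ∨ (2 * a ≤ m ∧ j + a ≤ jl))) → j + m = jl + a →
      (wP j a = if 2 * j + d ≤ 2 * jl + 1 ∧ (j + a + 2 ≤ m + 2 * d ∨ ε = 1) then (if j + a + 2 ≤ m + 2 * d then 1 else 2) * (q : ℚ) ^ (j - (j + a - m + 1) / 2) else 0) ∧
      (wM j a = if 2 * j + d ≤ 2 * jl + 1 ∧ (j + a + 2 ≤ m + 2 * d ∨ ε = -1) then (if j + a + 2 ≤ m + 2 * d then 1 else 2) * (q : ℚ) ^ (j - (j + a - m + 1) / 2) else 0) :=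
    fun j a hg htop => by
    have hc : ¬ (a ≤ m ∧ (j + a ≤ m ∨ (2 * a ≤ m ∧ j + a ≤ jl))) ∧ j + m = jl + a := ⟨hg, htop⟩
    rw [hwP, hwM]; dsimp only
    rw [if_pos hc, if_pos hc]
    exact ⟨rfl, rfl⟩
  -- the two cut sums agree: the tables differ only on top cells beyond the standard alive boundary, and those are cut
  have hagree : ∀ j a, ¬ (j + m = jl + a ∧ 2 * jl + 1 < 2 * j + d) → vP j a = wP j a ∧ vM j a = wM j a := fun j a hna => by
    rw [hwP, hwM]; dsimp only
    by_cases hcase : ¬ (a ≤ m ∧ (j + a ≤ m ∨ (2 * a ≤ m ∧ j + a ≤ jl))) ∧ j + m = jl + a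
    · rw [if_pos hcase, if_pos hcase]
      obtain ⟨hP, hM⟩ := hvTopE j a hcase.1 hcase.2
      have halive : 2 * j + d ≤ 2 * jl + 1 := by
        by_contra hlt
        exact hna ⟨hcase.2, by omega⟩
      have hiffP : (2 * j + d ≤ 2 * jl + 1 + e ∧ (j + a + 2 ≤ m + 2 * d ∨ ε = 1)) ↔ (2 * j + d ≤ 2 * jl + 1 ∧ (j + a + 2 ≤ m + 2 * d ∨ ε = 1)) := by
        constructor <;> rintro ⟨h1, h2⟩ <;> exact ⟨by omega, h2⟩
      have hiffM : (2 * j + d ≤ 2 * jl + 1 + e ∧ (j + a + 2 ≤ m + 2 * d ∨ ε = -1)) ↔ (2 * j + d ≤ 2 * jl + 1 ∧ (j + a + 2 ≤ m + 2 * d ∨ ε = -1)) := by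
        constructor <;> rintro ⟨h1, h2⟩ <;> exact ⟨by omega, h2⟩
      rw [hP, hM, if_congr hiffP rfl rfl, if_congr hiffM rfl rfl]
      exact ⟨rfl, rfl⟩
    · rw [if_neg hcase, if_neg hcase]
      exact ⟨rfl, rfl⟩
  rw [cutSum_eq_of_agree_below_alive (q : ℚ) hCe vP vM wP wM hagree]
  exact toricCensusSum_ramK_cut q ε hq hd hjl hjlS hpar hmS hm hε nP nM wP wM hnP hnM hwGen hwOff hwTop C hC

end Summit.HodgeConjecture.HodgeConjecture.Cruxes.H413.F0P3cDyRamToricCensusSumRamKCutOffset
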